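import Summits.SmoothPoincare4.SmoothPoincare4.Theses.WeakReductionDescent
import Literature.Topology.FourManifolds.DependentTripleGenusThreeTrisectionsProofs
import Literature.Topology.FourManifolds.LoopSurgeryHomotopySphere
import Literature.Topology.FourManifolds.HomotopyS4OrientableProofs

/-!
# Sketch (crux-ideate, ideator 2) for crux `DependentTripleGenusThreeStandard` (stmt-SmoothPoincare4-18000)

First lemmas of the two idea cards filed by this seat, typed over existing declarations, plus the
kernel-checked LOGIC showing how they compose into the outstanding core of the crux — the
hypothesis `hcore` of
`Literature.Topology.FourManifolds.arandaZupan_dependentTriple_genusThree_homotopySphere_of_weaklyReducible_of_notWeaklyReducible`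
("a smooth `M ≃ₕ S⁴` with a genus-3 GK-trisection admitting a dependent triple that is NOT weakly
reducible is `≅ S⁴`", Aranda–Zupan 2025 §7 case (3)).

* Card `cap-sphere-surgery`: `CapSphereLoopPartner` (the 4-dimensional cut-and-paste lemma: a
  pants-type triple with a doubly primitive cuff makes `M` a loop surgery `X′_ℓ` on a closed
  4-manifold `X′` carrying a GENUS-2 GK-trisection) and the glue `pantsTripleStandard_of`
  (`… → msz_loopSurgery_homotopySphere_gk → PantsTripleStandard`, PROVED).
* Card `torsion-handle-addition`: `PrimitiveOrReducing` (AZ25 Lemma 3.7 for the genus-3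
  splittings `∂X_l = H_i ∪_F H_j ≅ S¹ × S²` of a homotopy sphere's sectors, in trisection
  clothing), `SeparatingPairReducing` (AZ25 Lemma 3.8 likewise, covering §7 cases (1)–(2)),
  `AnnulusTrick`, and the glue `pantsCuffPrimitive_of` (three applications of 3.7 + the trick ⇒ a
  doubly primitive cuff, PROVED) and `notWeaklyReducibleCore_of` (PROVED).

Nothing here is a registered skeleton (crux-ideate files no skeleton); the `stub`-free glue only
certifies that the statements have the right shape.  Transversality of the one-point
intersections (`MeetsOnce`) is deliberately left set-theoretic; a crux-plan seat should add it.
-/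

noncomputable section

open scoped Manifold ContDiff Topology
open Set ContinuousMap

namespace Summit.SmoothPoincare4.SmoothPoincare4.Cruxes.DependentTripleGenusThreeStandard.Ideator2

open Literature.Topology.FourManifolds
open Literature.Topology.FourManifolds.Trisection

set_option linter.unusedVariables false
set_option linter.dupNamespace false

/-- Local notation: `𝔼 n = ℝⁿ`. -/
local notation "𝔼 " n:arg => EuclideanSpace ℝ (Fin n)

/-- Local notation: the unit sphere `Sⁿ ⊂ ℝⁿ⁺¹`. -/
local notation "𝕊 " n:arg => (Metric.sphere (0 : EuclideanSpace ℝ (Fin (n + 1))) 1)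

/-! ### Vocabulary on top of `Trisection.IsCurve / BoundsDisc / IsNonSeparating` -/

section Vocabulary

variable {X : Type} [TopologicalSpace X] [ChartedSpace (𝔼 4) X]

/-- Two curves on the central surface meet in exactly one point (set-theoretic; transversality to
be added downstream). [folklore] -/
def MeetsOnce (a d : Set X) : Prop := ∃ x : X, a ∩ d = {x}

/-- `a` is PRIMITIVE in the handlebody `H_p = spineHandlebody S p`: some compressing curve `d` of
`H_p` meets `a` exactly once (AZ25 §2 p. 3: "`c′` is primitive in `H` if there exists a
compressing curve `c` for `H` such that `|c ∩ c′| = 1`"). [cite: ArandaZupan2025, §2 (p. 3)] -/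
def IsPrimitiveIn (S : Fin 3 → Set X) (p : Fin 3) (a : Set X) : Prop :=
  ∃ d : Set X, IsCurve S d ∧ BoundsDisc S (spineHandlebody S p) d ∧ MeetsOnce a d

/-- A dependent triple of TYPE (3) (AZ25 §7 p. 24: "no two curves are homologous"), indexed:
`f i` is a non-separating curve compressing in `H_i`, the three are pairwise disjoint, every PAIR
is mutually non-separating, and the union of the three separates the central surface.  (By
Euler characteristic such a triple cobounds a pair of pants — `CoboundPants` below is kept as a
separate, explicit hypothesis of the 4-dimensional lemma.) [cite: ArandaZupan2025, §7 (p. 24), case (3)] -/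
def IsPantsTriple (S : Fin 3 → Set X) (f : Fin 3 → Set X) : Prop :=
  (∀ i, IsCurve S (f i)) ∧ (Pairwise fun i j => Disjoint (f i) (f j)) ∧
    (∀ i, IsNonSeparating S (f i)) ∧ (∀ i, BoundsDisc S (spineHandlebody S i) (f i)) ∧
    (∀ i j, i ≠ j → IsConnected (centralSurfaceSet S \ (f i ∪ f j))) ∧
    ¬ IsPreconnected (centralSurfaceSet S \ ⋃ i, f i)

end Vocabulary

/-- The planar PAIR-OF-PANTS model: the closed disc of radius `4` in `ℝ²` minus the open unit
discs centred at `(±2, 0)`; its boundary is the union of the three circles. [folklore] -/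
def pantsModel : Set (𝔼 2) :=
  Metric.closedBall (0 : 𝔼 2) 4 \
    (Metric.ball (EuclideanSpace.single (0 : Fin 2) (2 : ℝ)) 1 ∪
      Metric.ball (EuclideanSpace.single (0 : Fin 2) (-2 : ℝ)) 1)

section Pants

variable {X : Type} [TopologicalSpace X] [ChartedSpace (𝔼 4) X]

/-- The curves `a, b, c` COBOUND AN EMBEDDED PAIR OF PANTS `P` in the central surface: a
topological embedding of `pantsModel` into `F` sending the outer circle onto `a` and the two
inner circles onto `b` and `c`. [cite: ArandaZupan2025, §7 (p. 24), case (3) and Fig. 18] -/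
def CoboundPants (S : Fin 3 → Set X) (a b c : Set X) : Prop :=
  ∃ φ : pantsModel → X, Topology.IsEmbedding φ ∧ range φ ⊆ centralSurfaceSet S ∧
    φ '' (Subtype.val ⁻¹' Metric.sphere (0 : 𝔼 2) 4) = a ∧
    φ '' (Subtype.val ⁻¹' Metric.sphere (EuclideanSpace.single (0 : Fin 2) (2 : ℝ)) 1) = b ∧
    φ '' (Subtype.val ⁻¹' Metric.sphere (EuclideanSpace.single (0 : Fin 2) (-2 : ℝ)) 1) = c

end Pants

/-! ### Card `torsion-handle-addition`: the 3-dimensional statements (AZ25 Lemmas 3.7 / 3.8) -/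

/-- **AZ25 Lemma 3.7 in trisection clothing** (first lemma of card `torsion-handle-addition`).
For a smooth homotopy 4-sphere `M` with a genus-3 GK-trisection `T` (so every `∂X_l` is
`S¹ × S²` with the genus-3 Heegaard splitting `H_i ∪_F H_j`, `{i, j, l} = {0, 1, 2}`): if `a`
compresses in `H_i`, `b` in `H_j`, `a, b` disjoint, non-separating and MUTUALLY non-separating,
then `a` is primitive in `H_j` by a compressing curve disjoint from `b`, or `b` is primitive in
`H_i` by a compressing curve disjoint from `a`, or `a` compresses in `H_j`, or `b` compresses in
`H_i`.  The card's claim is that this admits a thin-position-free proof (type trichotomy for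
`H′[c]`, `H₁(S¹ × S²)` torsion-free, handle-addition lemma, two-sided incompressibility).
[cite: ArandaZupan2025, Lemma 3.7 (p. 9)] -/
def PrimitiveOrReducing : Prop :=
  ∀ (M : Type) [TopologicalSpace M] [T2Space M] [SecondCountableTopology M]
    [ChartedSpace (𝔼 4) M] [IsManifold (𝓡 4) ∞ M],
    M ≃ₕ 𝕊 4 → ∀ (k : Fin 3 → ℕ) (T : Fin 3 → Set M), IsGKTrisection M 3 k T →
    ∀ (i j : Fin 3), i ≠ j → ∀ (a b : Set M),
      IsCurve T a → IsCurve T b →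
      BoundsDisc T (spineHandlebody T i) a → BoundsDisc T (spineHandlebody T j) b →
      Disjoint a b → IsNonSeparating T a → IsNonSeparating T b →
      IsConnected (centralSurfaceSet T \ (a ∪ b)) →
      (∃ b', IsCurve T b' ∧ BoundsDisc T (spineHandlebody T j) b' ∧ MeetsOnce a b' ∧ Disjoint b' b) ∨
      (∃ a', IsCurve T a' ∧ BoundsDisc T (spineHandlebody T i) a' ∧ MeetsOnce b a' ∧ Disjoint a' a) ∨
      BoundsDisc T (spineHandlebody T j) a ∨ BoundsDisc T (spineHandlebody T i) b

/-- **AZ25 Lemma 3.8 in trisection clothing, with the parallel case folded in**: same setting,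
but now `a ∪ b` SEPARATES the central surface (the two curves are homologous: AZ25 §7 cases (1)
and (2)); then `a` compresses in `H_j` or `b` compresses in `H_i`.
[cite: ArandaZupan2025, Lemma 3.8 (p. 10) and §7 (p. 25), cases (1)–(2)] -/
def SeparatingPairReducing : Prop :=
  ∀ (M : Type) [TopologicalSpace M] [T2Space M] [SecondCountableTopology M]
    [ChartedSpace (𝔼 4) M] [IsManifold (𝓡 4) ∞ M],
    M ≃ₕ 𝕊 4 → ∀ (k : Fin 3 → ℕ) (T : Fin 3 → Set M), IsGKTrisection M 3 k T →
    ∀ (i j : Fin 3), i ≠ j → ∀ (a b : Set M),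
      IsCurve T a → IsCurve T b →
      BoundsDisc T (spineHandlebody T i) a → BoundsDisc T (spineHandlebody T j) b →
      Disjoint a b → IsNonSeparating T a → IsNonSeparating T b →
      ¬ IsConnected (centralSurfaceSet T \ (a ∪ b)) →
      BoundsDisc T (spineHandlebody T j) a ∨ BoundsDisc T (spineHandlebody T i) b

/-- **Annulus trick.**  For a pants-type triple `f`, the two cuffs `f i`, `f i'` different from
`f j` become ISOTOPIC in `∂(H_j ∖ D_{f j})` (the pants with the scar of `D_{f j}` glued in is an
annulus), so one is primitive in `H_j` iff the other is (transport a dual disc made disjoint from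
`D_{f j}` by outermost-arc surgery).  Handlebody topology, size M. [cite: ArandaZupan2025, §7 (p. 25)] -/
def AnnulusTrick : Prop :=
  ∀ (M : Type) [TopologicalSpace M] [T2Space M] [SecondCountableTopology M]
    [ChartedSpace (𝔼 4) M] [IsManifold (𝓡 4) ∞ M],
    M ≃ₕ 𝕊 4 → ∀ (k : Fin 3 → ℕ) (T : Fin 3 → Set M), IsGKTrisection M 3 k T →
    ∀ f : Fin 3 → Set M, IsPantsTriple T f →
      ∀ (i i' j : Fin 3), i ≠ j → i' ≠ j → (IsPrimitiveIn T j (f i) ↔ IsPrimitiveIn T j (f i'))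

/-- **A doubly primitive cuff** (the OUTPUT of the 3-dimensional layer, = what AZ25 §7 case (3)
extracts from Lemma 3.7 before building the five-chain): for a homotopy 4-sphere with a genus-3
GK-trisection that is not weakly reducible, some cuff `f i₀` of a pants-type triple is primitive
in both other handlebodies. [cite: ArandaZupan2025, §7 (p. 25)] -/
def PantsCuffPrimitive : Prop :=
  ∀ (M : Type) [TopologicalSpace M] [T2Space M] [SecondCountableTopology M]
    [ChartedSpace (𝔼 4) M] [IsManifold (𝓡 4) ∞ M],
    M ≃ₕ 𝕊 4 → ∀ (k : Fin 3 → ℕ) (T : Fin 3 → Set M), IsGKTrisection M 3 k T →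
    ∀ f : Fin 3 → Set M, IsPantsTriple T f → ¬ IsWeaklyReducible T →
      ∃ i₀ : Fin 3, ∀ j, j ≠ i₀ → IsPrimitiveIn T j (f i₀)

/-! ### Card `cap-sphere-surgery`: the 4-dimensional lemma -/

/-- **Euler characteristic / surface topology (size M): a type-(3) triple cobounds a pair of pants.**
Cutting the genus-3 central surface along three pairwise disjoint, pairwise mutually
non-separating curves whose union separates leaves exactly two components with one copy of each
cuff in each boundary; `χ = -4` forces genera `{0, 1}`, and the genus-0 piece is the pants.
[cite: ArandaZupan2025, §7 (p. 24), case (3)] -/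
def PantsOfNonseparatingPairs : Prop :=
  ∀ (M : Type) [TopologicalSpace M] [T2Space M] [SecondCountableTopology M]
    [ChartedSpace (𝔼 4) M] [IsManifold (𝓡 4) ∞ M],
    M ≃ₕ 𝕊 4 → ∀ (k : Fin 3 → ℕ) (T : Fin 3 → Set M), IsGKTrisection M 3 k T →
    ∀ f : Fin 3 → Set M, IsPantsTriple T f → CoboundPants T (f 0) (f 1) (f 2)

/-- **CAP-SPHERE SURGERY** (first lemma of card `cap-sphere-surgery`; AZ25 Lemma 5.4 + Prop. 5.5
WITHOUT five-chains, ⋆-trisections or Property R).  Let `M` be an orientable smooth 4-manifold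
with a genus-3 GK-trisection `T`, and `f` a pants-type triple (`f i` compresses in `H_i` by a
disc `D_i`, the three cuffs cobound a pants `P ⊂ F`) whose cuff `f i₀` is primitive in both other
handlebodies.  The cap sphere `Q = P ∪ D_0 ∪ D_1 ∪ D_2` is an embedded 2-sphere; its face
`Δ = Q ∖ D̊_{i₀}` is an embedded disc in `∂X_{i₀}` bounded by `f i₀` whose disc framing is the
surface framing, so `X_{i₀} ∪ ν(D_{i₀}) ≅ X_{i₀} ♮ (S² × D²)` (2-handle on a 0-framed unknot);
surgering `Q` (replace `S² × D²` by `S¹ × B³`) yields a closed smooth 4-manifold `X′` in which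
the surgered sector `♮²(S¹ × B³)` and the two untouched sectors form a GENUS-2 GK-trisection
(interfaces `H_j[f i₀]`, handlebodies because `f i₀` is primitive in `H_j`, and `H_{i₀} ∖ D_{i₀}`),
and `M` is the surgery on the core loop `ℓ` of the new `S¹ × B³`.
[cite: ArandaZupan2025, Lemma 5.4 and Prop. 5.5 (pp. 19–20), §7 (pp. 25–26)] -/
def CapSphereLoopPartner : Prop :=
  ∀ (M : Type) [TopologicalSpace M] [T2Space M] [SecondCountableTopology M]
    [ChartedSpace (𝔼 4) M] [IsManifold (𝓡 4) ∞ M],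
    IsOrientable (𝓡 4) M → ∀ (k : Fin 3 → ℕ) (T : Fin 3 → Set M), IsGKTrisection M 3 k T →
    ∀ f : Fin 3 → Set M, IsPantsTriple T f → CoboundPants T (f 0) (f 1) (f 2) →
    ∀ i₀ : Fin 3, (∀ j, j ≠ i₀ → IsPrimitiveIn T j (f i₀)) →
      ∃ (X' : Type) (_ : TopologicalSpace X') (_ : T2Space X') (_ : SecondCountableTopology X')
        (_ : ChartedSpace (𝔼 4) X') (_ : IsManifold (𝓡 4) ∞ X') (_ : CompactSpace X')
        (_ : ConnectedSpace X') (k' : Fin 3 → ℕ) (T' : Fin 3 → Set X') (ℓ : 𝕊 1 → X'),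
        IsOrientable (𝓡 4) X' ∧ IsGKTrisection X' 2 k' T' ∧ k' i₀ = k i₀ + 1 ∧
          (∀ j, j ≠ i₀ → k' j = k j) ∧
          Manifold.IsSmoothEmbedding (𝓡 1) (𝓡 4) ∞ ℓ ∧ IsCircleSurgery (𝓡 4) (𝓡 4) X' M ℓ

/-! ### Targets -/

/-- The pants branch of the crux: a homotopy 4-sphere with a genus-3 GK-trisection that admits a
pants-type dependent triple and is not weakly reducible is `≅ S⁴` — exactly the hypothesis `h5` of
`arandaZupan_dependentTriple_genusThree_homotopySphere_of_facts_of_fiveChainCase` without its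
(unneeded) irreducibility and type clauses. [cite: ArandaZupan2025, Thm. 1.4 and §7 (pp. 25–26)] -/
def PantsTripleStandard : Prop :=
  ∀ (M : Type) [TopologicalSpace M] [T2Space M] [SecondCountableTopology M]
    [ChartedSpace (𝔼 4) M] [IsManifold (𝓡 4) ∞ M],
    M ≃ₕ 𝕊 4 → ∀ (k : Fin 3 → ℕ) (T : Fin 3 → Set M), IsGKTrisection M 3 k T →
    ∀ f : Fin 3 → Set M, IsPantsTriple T f → ¬ IsWeaklyReducible T →
      Nonempty (M ≃ₘ⟮𝓡 4, 𝓡 4⟯ 𝕊 4)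

/-- The full not-weakly-reducible core of the crux — verbatim the hypothesis `hcore` of
`arandaZupan_dependentTriple_genusThree_homotopySphere_of_weaklyReducible_of_notWeaklyReducible`.
[cite: ArandaZupan2025, Thm. 1.4 and §7 (p. 25)] -/
def NotWeaklyReducibleCore : Prop :=
  ∀ (M : Type) [TopologicalSpace M] [T2Space M] [SecondCountableTopology M]
    [ChartedSpace (𝔼 4) M] [IsManifold (𝓡 4) ∞ M],
    M ≃ₕ 𝕊 4 → ∀ (k : Fin 3 → ℕ) (T : Fin 3 → Set M), IsGKTrisection M 3 k T →
      HasDependentTriple T → ¬ IsWeaklyReducible T → Nonempty (M ≃ₘ⟮𝓡 4, 𝓡 4⟯ 𝕊 4)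

/-! ### Logic: how the pieces compose (PROVED) -/

section Glue

variable {X : Type} [TopologicalSpace X] [ChartedSpace (𝔼 4) X]

/-- A cuff compressing in a second handlebody, with the third cuff, is a weak reduction (indexed
form of `Trisection.isWeaklyReducible_of_boundsDisc_two`). [cite: ArandaZupan2025, §7 (p. 25)] -/
theorem isWeaklyReducible_of_cuff_boundsDisc_other {S : Fin 3 → Set X} {f : Fin 3 → Set X}
    (hcur : ∀ i, IsCurve S (f i)) (hdis : Pairwise fun i j => Disjoint (f i) (f j))
    (hns : ∀ i, IsNonSeparating S (f i)) (hbd : ∀ i, BoundsDisc S (spineHandlebody S i) (f i))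
    {i j : Fin 3} (hij : i ≠ j) (h : BoundsDisc S (spineHandlebody S j) (f i)) :
    IsWeaklyReducible S := by
  have key : ∀ i j q : Fin 3, i ≠ j → q ≠ -(i + j) → q = i ∨ q = j := by decide
  have key2 : ∀ i j : Fin 3, i ≠ j → -(i + j) ≠ i := by decide
  refine ⟨-(i + j), f (-(i + j)), f i, hcur _, hcur _, hdis (key2 i j hij), hns _, hns _, hbd _,
    fun q hq => ?_⟩
  rcases key i j q hij hq with rfl | rfl
  · exact hbd q
  · exact h

end Glue

/-- **Three applications of Lemma 3.7 plus the annulus trick give a doubly primitive cuff**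
(pure logic; this is the bookkeeping AZ25 §7 p. 25 does by "these two possibilities are symmetric
up to permutation"). [cite: ArandaZupan2025, §7 (p. 25)] -/
theorem pantsCuffPrimitive_of (h37 : PrimitiveOrReducing) (htrick : AnnulusTrick) :
    PantsCuffPrimitive := by
  intro M _ _ _ _ _ e k T hT f hf hwr
  obtain ⟨hcur, hdis, hns, hbd, hconn, hdep⟩ := hf
  have hf' : IsPantsTriple T f := ⟨hcur, hdis, hns, hbd, hconn, hdep⟩
  -- one application of Lemma 3.7 to the pair (f i ⊂ H_i, f j ⊂ H_j), reducing outputs excluded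
  have app : ∀ i j : Fin 3, i ≠ j → IsPrimitiveIn T j (f i) ∨ IsPrimitiveIn T i (f j) := by
    intro i j hij
    rcases h37 M e k T hT i j hij (f i) (f j) (hcur i) (hcur j) (hbd i) (hbd j) (hdis hij)
        (hns i) (hns j) (hconn i j hij) with ⟨b', hb', hdb', hm, -⟩ | ⟨a', ha', hda', hm, -⟩ | h | h
    · exact Or.inl ⟨b', hb', hdb', hm⟩
    · exact Or.inr ⟨a', ha', hda', hm⟩
    · exact absurd (isWeaklyReducible_of_cuff_boundsDisc_other hcur hdis hns hbd hij h) hwr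
    · exact absurd (isWeaklyReducible_of_cuff_boundsDisc_other hcur hdis hns hbd hij.symm h) hwr
  -- A := f0 prim H1, A' := f1 prim H0, B := f0 prim H2, B' := f2 prim H0, C := f1 prim H2, C' := f2 prim H1
  have h01 := app 0 1 (by decide)
  have h02 := app 0 2 (by decide)
  have h12 := app 1 2 (by decide)
  have tB' : IsPrimitiveIn T 0 (f 2) ↔ IsPrimitiveIn T 0 (f 1) :=
    htrick M e k T hT f hf' 2 1 0 (by decide) (by decide)
  have tC : IsPrimitiveIn T 2 (f 1) ↔ IsPrimitiveIn T 2 (f 0) :=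
    htrick M e k T hT f hf' 1 0 2 (by decide) (by decide)
  have tC' : IsPrimitiveIn T 1 (f 2) ↔ IsPrimitiveIn T 1 (f 0) :=
    htrick M e k T hT f hf' 2 0 1 (by decide) (by decide)
  by_cases hA' : IsPrimitiveIn T 0 (f 1)
  · rcases h12 with hC | hC'
    · -- cuff 1 is primitive in H_0 (A') and H_2 (C)
      refine ⟨1, fun j hj => ?_⟩
      fin_cases j
      · exact hA'
      · exact absurd rfl hj
      · exact hC
    · -- cuff 2 is primitive in H_0 (B' = A') and H_1 (C')
      refine ⟨2, fun j hj => ?_⟩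
      fin_cases j
      · exact tB'.mpr hA'
      · exact hC'
      · exact absurd rfl hj
  · have hA : IsPrimitiveIn T 1 (f 0) := h01.resolve_right hA'
    have hB : IsPrimitiveIn T 2 (f 0) := by
      rcases h02 with hB | hB'
      · exact hB
      · exact absurd (tB'.mp hB') hA'
    refine ⟨0, fun j hj => ?_⟩
    fin_cases j
    · exact absurd rfl hj
    · exact hA
    · exact hB

/-- **The pants branch from the pieces**: doubly primitive cuff (3-D layer) + cap-sphere surgery
(4-D lemma) + the tree's named fact `msz_loopSurgery_homotopySphere_gk` (MSZ16 + Pao: a homotopy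
4-sphere that is a loop surgery on a manifold with a trisection in the Meier–Schirmer–Zupan range
is `S⁴`).  Pure logic. [cite: ArandaZupan2025, §7 (pp. 25–26)] [cite: MeierSchirmerZupan2016, Thm. 1.2] -/
theorem pantsTripleStandard_of (hcuff : PantsCuffPrimitive) (hpants : PantsOfNonseparatingPairs)
    (hcap : CapSphereLoopPartner) (hmsz : msz_loopSurgery_homotopySphere_gk) :
    PantsTripleStandard := by
  intro M _ _ _ _ _ e k T hT f hf hwr
  obtain ⟨i₀, hi₀⟩ := hcuff M e k T hT f hf hwr
  have hor : IsOrientable (𝓡 4) M := isOrientable_of_homotopyEquiv_sphere_four_holds M e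
  obtain ⟨X', _, _, _, _, _, _, _, k', T', ℓ, hX'or, hT', hk', -, hℓ, hsurg⟩ :=
    hcap M hor k T hT f hf (hpants M e k T hT f hf) i₀ hi₀
  exact hmsz X' hX'or 2 k' T' hT' ⟨i₀, by omega⟩ ℓ hℓ M e hsurg

/-- **The whole not-weakly-reducible core from the pieces**: AZ25 §7 cases (1)–(2) are a
SEPARATING pair, disposed of by Lemma 3.8 (they make `T` weakly reducible, contradiction); case
(3) is the pants branch.  Pure logic over `Trisection.hasDependentTriple_iff_exists_fun`.
[cite: ArandaZupan2025, §7 (p. 25)] -/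
theorem notWeaklyReducibleCore_of (h38 : SeparatingPairReducing) (hp : PantsTripleStandard) :
    NotWeaklyReducibleCore := by
  intro M _ _ _ _ _ e k T hT hdt hwr
  rw [hasDependentTriple_iff_exists_fun] at hdt
  obtain ⟨f, hcur, hdis, hns, hbd, hdep⟩ := hdt
  by_cases hconn : ∀ i j : Fin 3, i ≠ j → IsConnected (centralSurfaceSet T \ (f i ∪ f j))
  · exact hp M e k T hT f ⟨hcur, hdis, hns, hbd, hconn, hdep⟩ hwr
  · push Not at hconn
    obtain ⟨i, j, hij, hsep⟩ := hconn
    rcases h38 M e k T hT i j hij (f i) (f j) (hcur i) (hcur j) (hbd i) (hbd j) (hdis hij)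
        (hns i) (hns j) hsep with h | h
    · exact absurd (isWeaklyReducible_of_cuff_boundsDisc_other hcur hdis hns hbd hij h) hwr
    · exact absurd (isWeaklyReducible_of_cuff_boundsDisc_other hcur hdis hns hbd hij.symm h) hwr

/-- **Sanity: the core closes the crux modulo the Thm 1.3 fact** (re-export of the tree's
reduction, so that the composition `pieces → NotWeaklyReducibleCore → (hWR →) X_F` is visible in
one file). [cite: ArandaZupan2025, Thm. 1.3 and Thm. 1.4 (p. 2)] -/
theorem dependentTripleGenusThreeStandard_of_core
    (hWR : arandaZupan_weaklyReducible_genusThree_homotopySphere)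
    (hcore : NotWeaklyReducibleCore) :
    Summit.SmoothPoincare4.SmoothPoincare4.Theses.WeakReductionDescent.DependentTripleGenusThreeStandard := by
  have h :=
    arandaZupan_dependentTriple_genusThree_homotopySphere_of_weaklyReducible_of_notWeaklyReducible
      hWR (fun M _ _ _ _ _ e k T hT hdt hwr => hcore M e k T hT hdt hwr)
  intro M _ _ _ _ _ e k T hT hdt
  exact h M e k T hT hdt

end Summit.SmoothPoincare4.SmoothPoincare4.Cruxes.DependentTripleGenusThreeStandard.Ideator2

end
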